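import Summits.QuantumFields.YangMills.Theorems.LuscherReductionTwistedTraceScalingVacuumPattern
import Summits.QuantumFields.YangMills.Theorems.LuscherReductionTwistedTraceScalingGaugeAverage
import HarnessLib

/-!
# The Haar measure of ANY finite product `SU(2)^ι` — in particular of the GAUGE GROUP `SU(2)^{sites}` — in the per-factor GNOMONIC chart
# (entrance to the Laplace asymptotics of the Faddeev–Popov weight `N = gaugeAvg 𝟙_T` and of the gauge-averaged kernel `avgKernel`; lane A of S-BASE,
# crux `TwistedTraceScaling` stmt-QuantumFields-20203, sub-target C4 INNER; design note `pub/ym-fleet/ym-luscher-20007-p1/COARSE-DESIGN.md` §23.2(3))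

`…LatticeGnChart` / `…VacuumPattern` wrote the a-priori measure of the LINKS (`configMeasure SU2 L`, index `Edge 3 L`) in gnomonic coordinates.  The
Faddeev–Popov computations of §23 integrate over the GAUGE GROUP (index `Site 3 L`, measure `gaugeMeasure L`).  This file does the bookkeeping once for an
ARBITRARY finite index type `ι`:
* `piPatternChart ι z w : ι → SU2` — factor `i` is `hemiChart (z i) (w i) = (±1)·P(1, w_i)`; `piGnDensity(Real) ι w = ∏_i w(w_i)`, `w(v) = (2π²)⁻¹(1+|v|²)⁻²`;
* ★ `pi_haar_su2_eq_sum_piPatternChart` — `⊗_i Haar = Σ_{z : ι → Bool} ((⊗_i dv)·∏_i w(w_i)) ∘ (piPatternChart z)⁻¹`;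
* `integral_pi_haar_eq_sum_piPatternChart` (bounded measurable integrands), ★ `integral_pi_haar_eq_vacuumChart` (integrands vanishing as soon as one factor
  lies in the closed lower hemisphere see only the vacuum pattern `z ≡ false`, where every factor is `P(1, w_i)`);
* the gauge-group instance ★ `integral_gaugeMeasure_eq_vacuumChart`.
HONEST FRAMING: measure bookkeeping (Fubini over factors); femto rung R2b1 (stub of a child of a CONDITIONAL route); no estimate; not a gap, not Clay.
-/

set_option autoImplicit false

noncomputable section

open MeasureTheory Filter Topology Real
open scoped ENNReal BigOperators
open Literature.MathematicalPhysics.QuantumFieldTheory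
open Literature.MathematicalPhysics.QuantumLattice
open Literature.MathematicalPhysics.QuantumFieldTheory.Balaban1983to89.T4CubeChartGnomonic (gnoPoint gnoWeight
  gnoWeight_pos gnoWeight_le measurable_gnoWeight continuous_gnoPoint)

namespace Summit.QuantumFields.YangMills.Theorems.FemtoTransferGap.TwoLattice.GnChart

open Summit.QuantumFields.YangMills.Theorems.FemtoTransferGap

variable (ι : Type*) [Fintype ι]

/-! ## §1 The pattern chart of a finite product -/

/-- **The per-factor gnomonic pattern chart of `SU(2)^ι`**: factor `i` carries `hemiChart (z i) (w i) = (±1)·P(1, w_i)`. [folklore] -/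
def piPatternChart (z : ι → Bool) (w : ι → Fin 3 → ℝ) : ι → SU2 := fun i => hemiChart (z i) (w i)

omit [Fintype ι] in
/-- The pattern chart is measurable. [folklore] -/
theorem measurable_piPatternChart (z : ι → Bool) : Measurable (piPatternChart ι z) :=
  measurable_pi_lambda _ fun i => (measurable_hemiChart (z i)).comp (measurable_pi_apply i)

/-- The product gnomonic density `∏_i w(w_i)` as an `ℝ≥0∞`-valued function. [folklore] -/
def piGnDensity (w : ι → Fin 3 → ℝ) : ℝ≥0∞ := ∏ i, ENNReal.ofReal (gnoWeight (w i))

/-- … and as a real function. [folklore] -/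
def piGnDensityReal (w : ι → Fin 3 → ℝ) : ℝ := ∏ i, gnoWeight (w i)

/-- `piGnDensity = ofReal ∘ piGnDensityReal`. [folklore] -/
theorem piGnDensity_eq (w : ι → Fin 3 → ℝ) : piGnDensity ι w = ENNReal.ofReal (piGnDensityReal ι w) := by
  unfold piGnDensity piGnDensityReal
  rw [ENNReal.ofReal_prod_of_nonneg fun i _ => (gnoWeight_pos (w i)).le]

/-- `0 < ∏_i w(w_i) ≤ (2π²)^{−|ι|}`. [folklore] -/
theorem piGnDensityReal_pos_le (w : ι → Fin 3 → ℝ) :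
    0 < piGnDensityReal ι w ∧ piGnDensityReal ι w ≤ ((2 * π ^ 2)⁻¹) ^ Fintype.card ι := by
  unfold piGnDensityReal
  refine ⟨Finset.prod_pos fun i _ => gnoWeight_pos _, ?_⟩
  rw [← Finset.card_univ, ← Finset.prod_const]
  exact Finset.prod_le_prod (fun i _ => (gnoWeight_pos _).le) fun i _ => gnoWeight_le _

/-- The density is measurable. [folklore] -/
theorem measurable_piGnDensity : Measurable (piGnDensity ι) := by
  unfold piGnDensity
  exact Finset.measurable_prod _ fun i _ => ENNReal.measurable_ofReal.comp (measurable_gnoWeight.comp (measurable_pi_apply i))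

/-- The real density is measurable. [folklore] -/
theorem measurable_piGnDensityReal : Measurable (piGnDensityReal ι) := by
  unfold piGnDensityReal
  exact Finset.measurable_prod _ fun i _ => measurable_gnoWeight.comp (measurable_pi_apply i)

/-! ## §2 The product Haar measure as a sum over hemisphere patterns -/

/-- ★ **Product Haar in the gnomonic chart**: `⊗_{i : ι} Haar_{SU(2)} = Σ_{z : ι → Bool} ((⊗_i dv) · ∏_i w(w_i)) ∘ (piPatternChart ι z)⁻¹`. [folklore] -/
theorem pi_haar_su2_eq_sum_piPatternChart :
    (Measure.pi fun _ : ι => haarProbability SU2) = Measure.sum fun z : ι → Bool =>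
      (((volume : Measure (ι → Fin 3 → ℝ)).withDensity (piGnDensity ι)).map (piPatternChart ι z)) := by
  haveI := isFiniteMeasure_gnoDensityMeasure
  rw [haarProbability_su2_eq_sum_hemiChart, pi_add_eq_sum_pi (fun b => gnoDensityMeasure.map (hemiChart b))]
  congr 1
  funext z
  have hpi : (Measure.pi fun _ : ι => gnoDensityMeasure).map (fun w i => hemiChart (z i) (w i)) =
      Measure.pi fun i => gnoDensityMeasure.map (hemiChart (z i)) :=
    Measure.pi_map_pi fun i => (measurable_hemiChart (z i)).aemeasurable
  rw [← hpi]
  have hdens : (Measure.pi fun _ : ι => gnoDensityMeasure) =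
      (volume : Measure (ι → Fin 3 → ℝ)).withDensity (piGnDensity ι) := by
    rw [gnoDensityMeasure, volume_pi]
    exact GaussianToolkit.pi_withDensity (fun _ : ι => (volume : Measure (Fin 3 → ℝ)))
      (fun _ => fun v => ENNReal.ofReal (gnoWeight v)) fun _ => ENNReal.measurable_ofReal.comp measurable_gnoWeight
  rw [hdens]
  rfl

/-- A bounded measurable real function is integrable for the product Haar probability measure. [folklore] -/
theorem integrable_pi_haar_of_bounded {g : (ι → SU2) → ℝ} (hg : Measurable g) (hb : ∃ C : ℝ, ∀ U, |g U| ≤ C) :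
    Integrable g (Measure.pi fun _ : ι => haarProbability SU2) := by
  obtain ⟨C, hC⟩ := hb
  exact Integrable.mono' (integrable_const C) hg.aestronglyMeasurable (ae_of_all _ fun U => by
    rw [Real.norm_eq_abs]; exact hC U)

/-- ★ **Change of variables for bounded measurable real integrands**:
`∫ g d(⊗_i Haar) = Σ_z ∫ (∏_i w(w_i)) · g(piPatternChart z w) dw`. [folklore] -/
theorem integral_pi_haar_eq_sum_piPatternChart [DecidableEq ι] {g : (ι → SU2) → ℝ} (hg : Measurable g) (hb : ∃ C : ℝ, ∀ U, |g U| ≤ C) :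
    ∫ U, g U ∂(Measure.pi fun _ : ι => haarProbability SU2) =
      ∑ z : ι → Bool, ∫ w, piGnDensityReal ι w * g (piPatternChart ι z w) ∂volume := by
  have hint := integrable_pi_haar_of_bounded ι hg hb
  rw [pi_haar_su2_eq_sum_piPatternChart ι] at hint ⊢
  rw [integral_sum_measure hint, tsum_fintype]
  refine Finset.sum_congr rfl fun z _ => ?_
  rw [integral_map (measurable_piPatternChart ι z).aemeasurable hg.aestronglyMeasurable,
    integral_withDensity_eq_integral_toReal_smul (measurable_piGnDensity ι)
      (ae_of_all _ fun w => by rw [piGnDensity_eq]; exact ENNReal.ofReal_lt_top)]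
  refine integral_congr_ae (ae_of_all _ fun w => ?_)
  show (piGnDensity ι w).toReal • g (piPatternChart ι z w) = piGnDensityReal ι w * g (piPatternChart ι z w)
  rw [piGnDensity_eq, ENNReal.toReal_ofReal (piGnDensityReal_pos_le ι w).1.le, smul_eq_mul]

/-! ## §3 Collapse to the vacuum pattern -/

omit [Fintype ι] in
/-- On the vacuum pattern every factor is `P(1, w_i)` (upper hemisphere). [folklore] -/
theorem piPatternChart_false (w : ι → Fin 3 → ℝ) (i : ι) : piPatternChart ι (fun _ => false) w i = gnoPoint (w i) := by
  simp [piPatternChart, hemiChart, hemi]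

omit [Fintype ι] in
/-- On a pattern with `z i = true` the factor `i` lies in the LOWER hemisphere. [folklore] -/
theorem scalarPart_piPatternChart_neg {z : ι → Bool} {i : ι} (hi : z i = true) (w : ι → Fin 3 → ℝ) :
    scalarPart (piPatternChart ι z w i) < 0 := by
  simp only [piPatternChart, hemiChart, hi, hemi, if_true]
  rw [scalarPart_negOne_mul]
  have := scalarPart_gnoPoint_pos (w i)
  linarith

omit [Fintype ι] in
/-- A pattern other than the vacuum pattern has a `true` factor. [folklore] -/
theorem exists_true_of_ne_false {z : ι → Bool} (hz : z ≠ fun _ => false) : ∃ i, z i = true := by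
  by_contra h
  push Not at h
  exact hz (funext fun i => by simpa using h i)

/-- ★ **Collapse to the vacuum pattern**: if the bounded measurable `g` vanishes on every element of `SU(2)^ι` having a factor with non-positive scalar part, then
`∫ g d(⊗_i Haar) = ∫ (∏_i w(w_i)) · g(i ↦ P(1, w_i)) dw`. [folklore] -/
theorem integral_pi_haar_eq_vacuumChart [DecidableEq ι] {g : (ι → SU2) → ℝ} (hg : Measurable g) (hb : ∃ C : ℝ, ∀ U, |g U| ≤ C)
    (h0 : ∀ V : ι → SU2, (∃ i, scalarPart (V i) ≤ 0) → g V = 0) :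
    ∫ U, g U ∂(Measure.pi fun _ : ι => haarProbability SU2) =
      ∫ w, piGnDensityReal ι w * g (piPatternChart ι (fun _ => false) w) ∂volume := by
  rw [integral_pi_haar_eq_sum_piPatternChart ι hg hb]
  rw [Finset.sum_eq_single (fun _ : ι => false)]
  · intro z _ hz
    obtain ⟨i, hi⟩ := exists_true_of_ne_false ι hz
    refine integral_eq_zero_of_ae (ae_of_all _ fun w => ?_)
    show piGnDensityReal ι w * g (piPatternChart ι z w) = 0
    rw [h0 _ ⟨i, (scalarPart_piPatternChart_neg ι hi w).le⟩, mul_zero]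
  · intro h; exact (h (Finset.mem_univ _)).elim

/-! ## §4 The gauge group of the torus -/

/-- ★ **The gauge-group Haar measure in the gnomonic chart, vacuum pattern**: for bounded measurable `g` on `SU(2)^{sites}` vanishing as soon as one value lies
in the closed lower hemisphere, `∫ g d(gaugeMeasure L) = ∫ (∏_x w(w_x)) · g(x ↦ P(1, w_x)) dw`. [folklore] -/
theorem integral_gaugeMeasure_eq_vacuumChart (L : ℕ) [NeZero L] {g : (Site 3 L → SU2) → ℝ} (hg : Measurable g) (hb : ∃ C : ℝ, ∀ h, |g h| ≤ C)
    (h0 : ∀ h : Site 3 L → SU2, (∃ x, scalarPart (h x) ≤ 0) → g h = 0) :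
    ∫ h, g h ∂(TwoLattice.Avg.gaugeMeasure L) =
      ∫ w, piGnDensityReal (Site 3 L) w * g (piPatternChart (Site 3 L) (fun _ => false) w) ∂volume :=
  integral_pi_haar_eq_vacuumChart (Site 3 L) hg hb h0

end Summit.QuantumFields.YangMills.Theorems.FemtoTransferGap.TwoLattice.GnChart

end
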